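import Mathlib
import HarnessLib
import Summits.HubbardSuperconductivity.HubbardSuperconductivity.Theorems.KLProgrammeH10TwoPointLimitKlAnisoTightBundleBricks

/-!
# Route `KLProgramme` — K3 engine (stmt-HubbardSuperconductivity-20437), stub (b) (ℓ)/(I2), located item «ON-CLASS-KB» (K):
# the TIGHT-BUNDLE count — on the umklapp-active class, the coarse tuples whose non-pinned legs all lie within `C′` sectors of one direction
# number `O(1)·(4(2C′+1))^m`, uniformly in the scale

Cell gate-hubbard-kl, seat p4 g13 (memo HOME/prover-p4/ON-CLASS-KB.md §2(a), CLAIM-U-API.md §4 (K)).  The TIGHT corner class of the on-class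
re-measurement — coarse tuples `σ′` (scale `k`) with the pinned leg's label fixed, all other legs' sign-absorbed (half-turned) sectors within `C′` sectors
(cyclically) of a common sector `b`, and signed centre points summing to within `(m+1)·C·w_k` of `2πG₀` coordinatewise — is SMALL: conservation pins the
bundle sector `b` to `O(1)` choices (two admissible `b` give centre points within `(4C + 2·Lip·C′)·w_k` of each other coordinatewise, hence — polar form
with radius `≥ u_min` — within `π(4C + 2LipC′)w_k/u_min` in torus angle), and given `b` each non-pinned leg has `≤ 4(2C′+1)` labels.  Stated for an
ABSTRACT centre map `P : ℝ → (Fin 2 → ℝ)` (polar with radius `≥ u_min`, centrally symmetric `P(θ+π) = −P θ`, `Lip`-continuous for the torus distance);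
the frame's `klFermiPoint μ K` is the intended instance (`klFermiPoint_add_pi`; its Lipschitz constant comes from `abs_deriv_klFermiRadius_le` — that
specialisation is not done in this file).

* **`card_tightBundle_target_le`** — the count `≤ (4π(4C + 2·Lip·C′)/u_min + 2)·(4(2C′+1))^m`.
PROVED; no definitions, no named facts; nothing here asserts anything about the model or superconductivity. [folklore] counting.
-/

noncomputable section

namespace Summit.HubbardSuperconductivity.HubbardSuperconductivity.Theorems.PerturbedFermiCurve

set_option linter.dupNamespace false -- summit = problem name (single-conjunct summit), D-0017

open Classical
open Real Set Finset
open Literature.MathematicalPhysics.QuantumLattice Literature.MathematicalPhysics.QuantumLattice.BandSectorCounting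
open Literature.MathematicalPhysics.QuantumLattice.FermiRG Literature.MathematicalPhysics.QuantumLattice.FermiRG.BGM2003

/-! ## The tight-bundle count -/

/-- **THE TIGHT-BUNDLE COUNT (K).**  Let `P : ℝ → ℝ²` be polar with radius `≥ u_min > 0`, centrally symmetric and `Lip`-continuous for the torus
distance (the frame's `klFermiPoint μ K`).  Fix the scale `k`, `m + 1 ≥ 2` legs, the pinned leg `p` with its label `ℓ`, a reciprocal vector `G₀`, the
class constant `C ≥ 0` and a cluster radius `C′`.  The coarse label tuples `σ′` with `σ′ p = ℓ`, signed centre points summing to within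
`(m+1)·C·w_k` of `2πG₀` coordinatewise, and all non-pinned half-turned indices within `C′` (cyclically) of a common sector `b`, number at most
`(4π(4C + 2·Lip·C′)/u_min + 2) · (4(2C′+1))^m` — uniformly in `k`. [folklore] -/
theorem card_tightBundle_target_le (P : ℝ → (Fin 2 → ℝ)) {umin Lip : ℝ} (humin : 0 < umin) (hLip0 : 0 ≤ Lip)
    (hpolar : ∀ θ, ∃ r : ℝ, umin ≤ r ∧ P θ = r • dir θ) (hanti : ∀ θ, P (θ + π) = -P θ)
    (hLip : ∀ θ θ' : ℝ, ∀ j : Fin 2, |P θ j - P θ' j| ≤ Lip * FermiRG.torusDist (θ - θ'))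
    {k m : ℕ} (hm : 1 ≤ m) (p : Fin (m + 1)) (ℓ : SectorLeg (sectorCount k)) (G₀ : Fin 2 → ℤ) {C : ℝ} (hC : 0 ≤ C) (C' : ℕ) :
    (((univ : Finset (Fin (m + 1) → SectorLeg (sectorCount k))).filter fun σ' =>
        σ' p = ℓ ∧
        (∀ j : Fin 2, |∑ i, (if (σ' i).2 = 0 then P (sectorCenter k (σ' i).1.1) j else -P (sectorCenter k (σ' i).1.1) j) -
            2 * π * (G₀ j : ℝ)| ≤ ((m : ℝ) + 1) * C * sectorWidth k) ∧
        ∃ b : Fin (sectorCount k), ∀ i, i ≠ p → ∃ D : ℤ, |D| ≤ C' ∧ (sectorCount k : ℤ) ∣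
          ((((if (σ' i).2 = 0 then ((σ' i).1.1 : ℕ) else
              if ((σ' i).1.1 : ℕ) < 2 ^ k then ((σ' i).1.1 : ℕ) + 2 ^ k else ((σ' i).1.1 : ℕ) - 2 ^ k : ℕ) : ℤ)) - b - D)).card : ℝ) ≤
      (4 * π * (4 * C + 2 * Lip * C') / umin + 2) * (4 * (2 * (C' : ℝ) + 1)) ^ m := by
  have hw := sectorWidth_pos k
  have hN := sectorCount_pos k
  have hπ := Real.pi_pos
  have hm1 : (1 : ℝ) ≤ m := by exact_mod_cast hm
  -- notation: the half-turned index of a label and the cluster predicate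
  set ht : SectorLeg (sectorCount k) → ℕ := fun x =>
    if x.2 = 0 then (x.1.1 : ℕ) else if (x.1.1 : ℕ) < 2 ^ k then (x.1.1 : ℕ) + 2 ^ k else (x.1.1 : ℕ) - 2 ^ k with hht
  have ht_lt : ∀ x : SectorLeg (sectorCount k), ht x < sectorCount k := by
    intro x; simp only [hht]
    by_cases h0 : x.2 = 0
    · rw [if_pos h0]; exact x.1.1.isLt
    · rw [if_neg h0]; exact halfTurnIdx_lt false x.1.1.isLt
  set S := (univ : Finset (Fin (m + 1) → SectorLeg (sectorCount k))).filter fun σ' =>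
      σ' p = ℓ ∧
      (∀ j : Fin 2, |∑ i, (if (σ' i).2 = 0 then P (sectorCenter k (σ' i).1.1) j else -P (sectorCenter k (σ' i).1.1) j) -
          2 * π * (G₀ j : ℝ)| ≤ ((m : ℝ) + 1) * C * sectorWidth k) ∧
      ∃ b : Fin (sectorCount k), ∀ i, i ≠ p → ∃ D : ℤ, |D| ≤ C' ∧ (sectorCount k : ℤ) ∣ (((ht (σ' i) : ℕ) : ℤ) - b - D) with hS
  have hSdef' : ∀ σ', σ' ∈ S ↔ σ' p = ℓ ∧
      (∀ j : Fin 2, |∑ i, (if (σ' i).2 = 0 then P (sectorCenter k (σ' i).1.1) j else -P (sectorCenter k (σ' i).1.1) j) -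
          2 * π * (G₀ j : ℝ)| ≤ ((m : ℝ) + 1) * C * sectorWidth k) ∧
      ∃ b : Fin (sectorCount k), ∀ i, i ≠ p → ∃ D : ℤ, |D| ≤ C' ∧ (sectorCount k : ℤ) ∣ (((ht (σ' i) : ℕ) : ℤ) - b - D) := by
    intro σ'; rw [hS, mem_filter]; exact ⟨fun h => h.2, fun h => ⟨mem_univ _, h⟩⟩
  show ((S.card : ℕ) : ℝ) ≤ _
  -- the fibre over a bundle sector `b`
  set Lbl : Fin (sectorCount k) → Finset (SectorLeg (sectorCount k)) := fun b =>
    univ.filter fun x => ∃ D : ℤ, |D| ≤ C' ∧ (sectorCount k : ℤ) ∣ (((ht x : ℕ) : ℤ) - b - D) with hLbl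
  have hLbl_card : ∀ b, ((Lbl b).card : ℝ) ≤ 4 * (2 * (C' : ℝ) + 1) := by
    intro b
    -- inject `x ↦ (D, spin, charge)`
    have hmem : ∀ x ∈ Lbl b, ∃ D : ℤ, |D| ≤ C' ∧ (sectorCount k : ℤ) ∣ (((ht x : ℕ) : ℤ) - b - D) := by
      intro x hx; rw [hLbl, mem_filter] at hx; exact hx.2
    choose! Df hDf using hmem
    set g : SectorLeg (sectorCount k) → ℤ × Fin 2 × Fin 2 := fun x => (Df x, x.1.2, x.2) with hg
    have hinj : Set.InjOn g (Lbl b) := by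
      intro x hx y hy hxy
      have hx' := hDf x (Finset.mem_coe.1 hx); have hy' := hDf y (Finset.mem_coe.1 hy)
      simp only [hg, Prod.mk.injEq] at hxy
      obtain ⟨hD, hsp, hch⟩ := hxy
      -- `ht x ≡ ht y (mod N)`, both `< N` ⇒ equal ⇒ indices equal (half-turn injective at fixed charge)
      have hcong : (sectorCount k : ℤ) ∣ (((ht x : ℕ) : ℤ) - ((ht y : ℕ) : ℤ)) := by
        have := dvd_sub hx'.2 hy'.2
        rw [hD] at this
        have e : ((ht x : ℕ) : ℤ) - b - Df y - (((ht y : ℕ) : ℤ) - b - Df y) = ((ht x : ℕ) : ℤ) - ((ht y : ℕ) : ℤ) := by ring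
        rwa [e] at this
      have heq : ht x = ht y := by
        have h1 := ht_lt x; have h2 := ht_lt y
        rcases hcong with ⟨t, htt⟩
        have : t = 0 := by
          by_contra hne
          rcases lt_or_gt_of_ne hne with hlt | hgt
          · have : t ≤ -1 := by omega
            nlinarith
          · have : 1 ≤ t := by omega
            nlinarith
        rw [this, mul_zero, sub_eq_zero] at htt
        exact_mod_cast htt
      have hidx : (x.1.1 : ℕ) = (y.1.1 : ℕ) := by
        have hx2 : ht x = (if decide (x.2 = 0) then (x.1.1 : ℕ) else if (x.1.1 : ℕ) < 2 ^ k then (x.1.1 : ℕ) + 2 ^ k else (x.1.1 : ℕ) - 2 ^ k) := by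
          simp only [hht]; by_cases h0 : x.2 = 0 <;> simp [h0]
        have hy2 : ht y = (if decide (x.2 = 0) then (y.1.1 : ℕ) else if (y.1.1 : ℕ) < 2 ^ k then (y.1.1 : ℕ) + 2 ^ k else (y.1.1 : ℕ) - 2 ^ k) := by
          simp only [hht]; rw [← hch]; by_cases h0 : x.2 = 0 <;> simp [h0]
        rw [hx2, hy2] at heq
        exact halfTurnIdx_injOn _ x.1.1.isLt y.1.1.isLt heq
      exact Prod.ext (Prod.ext (Fin.ext hidx) hsp) hch
    have hrange : ∀ x ∈ Lbl b, g x ∈ (Finset.Icc (-(C' : ℤ)) C') ×ˢ ((univ : Finset (Fin 2)) ×ˢ (univ : Finset (Fin 2))) := by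
      intro x hx
      rw [Finset.mem_product, Finset.mem_product, Finset.mem_Icc]
      exact ⟨abs_le.1 (hDf x hx).1, mem_univ _, mem_univ _⟩
    have hc := Finset.card_le_card_of_injOn g hrange hinj
    rw [Finset.card_product, Finset.card_product, Finset.card_univ, Fintype.card_fin, Int.card_Icc] at hc
    have e : (((C' : ℤ) + 1 - -(C' : ℤ)).toNat : ℝ) = 2 * C' + 1 := by
      have : (C' : ℤ) + 1 - -(C' : ℤ) = ((2 * C' + 1 : ℕ) : ℤ) := by push_cast; ring
      rw [this, Int.toNat_natCast]; push_cast; ring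
    have : ((Lbl b).card : ℝ) ≤ (((C' : ℤ) + 1 - -(C' : ℤ)).toNat * (2 * 2) : ℕ) := by exact_mod_cast hc
    rw [Nat.cast_mul, e] at this
    push_cast at this
    linarith
  set T : Fin (sectorCount k) → Finset (Fin (m + 1) → SectorLeg (sectorCount k)) := fun b =>
    Fintype.piFinset fun i => if i = p then {ℓ} else Lbl b with hT
  have hT_card : ∀ b, ((T b).card : ℝ) ≤ (4 * (2 * (C' : ℝ) + 1)) ^ m := by
    intro b
    rw [hT, Fintype.card_piFinset]
    have h1 : ∀ i, (((if i = p then ({ℓ} : Finset _) else Lbl b).card : ℕ) : ℝ) ≤ if i = p then 1 else 4 * (2 * (C' : ℝ) + 1) := by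
      intro i; by_cases hi : i = p
      · simp [hi]
      · rw [if_neg hi, if_neg hi]; exact hLbl_card b
    calc (((∏ i, (if i = p then ({ℓ} : Finset _) else Lbl b).card : ℕ) : ℝ)) = ∏ i, (((if i = p then ({ℓ} : Finset _) else Lbl b).card : ℕ) : ℝ) := by
          push_cast; rfl
      _ ≤ ∏ i : Fin (m + 1), (if i = p then (1 : ℝ) else 4 * (2 * (C' : ℝ) + 1)) :=
          Finset.prod_le_prod (fun i _ => by positivity) (fun i _ => h1 i)
      _ = (4 * (2 * (C' : ℝ) + 1)) ^ m := by
          rw [Finset.prod_ite, Finset.prod_const_one, one_mul, Finset.prod_const]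
          congr 1
          have : (univ.filter fun i : Fin (m + 1) => ¬ i = p) = univ.erase p := by ext i; simp
          rw [this, Finset.card_erase_of_mem (mem_univ _), Finset.card_univ, Fintype.card_fin]; rfl
  -- empty or not
  rcases S.eq_empty_or_nonempty with hS0 | ⟨σ₀, hσ₀⟩
  · rw [hS0, Finset.card_empty, Nat.cast_zero]; positivity
  obtain ⟨-, -, b₀, -⟩ := (hSdef' σ₀).1 hσ₀
  -- the key estimate: every admissible bundle sector is within `δ′` of `b₀`… no: of ANY admissible sector; we compare with `σ₀`'s `b₀`
  obtain ⟨hσ₀p, hon₀, b₀', hb₀'⟩ := (hSdef' σ₀).1 hσ₀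
  clear b₀
  set δ' : ℝ := π * ((4 * C + 2 * Lip * C') * sectorWidth k) / umin with hδ'
  have hδ'0 : 0 ≤ δ' := by positivity
  -- coordinate estimate for one admissible `(σ′, b)`: `|m·P(θ_b) − (2πG₀ − s_p P(c_p))| ≤ (m+1)Cw + m·Lip·C′·w`
  have hkey : ∀ σ' ∈ S, ∀ b : Fin (sectorCount k),
      (∀ i, i ≠ p → ∃ D : ℤ, |D| ≤ C' ∧ (sectorCount k : ℤ) ∣ (((ht (σ' i) : ℕ) : ℤ) - b - D)) →
      ∀ j : Fin 2, |(m : ℝ) * P (sectorCenter k b) j -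
        (2 * π * (G₀ j : ℝ) - (if ℓ.2 = 0 then P (sectorCenter k ℓ.1.1) j else -P (sectorCenter k ℓ.1.1) j))| ≤
        ((m : ℝ) + 1) * C * sectorWidth k + m * (Lip * (C' * sectorWidth k)) := by
    intro σ' hσ' b hb j
    obtain ⟨hσp, hon, -⟩ := (hSdef' σ').1 hσ'
    have honj := hon j
    -- each non-pinned leg is within `Lip·C′·w` of `P(θ_b)`
    have hleg : ∀ i, i ≠ p → |(if (σ' i).2 = 0 then P (sectorCenter k (σ' i).1.1) j else -P (sectorCenter k (σ' i).1.1) j) -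
        P (sectorCenter k b) j| ≤ Lip * (C' * sectorWidth k) := by
      intro i hi
      obtain ⟨D, hD, hdvd⟩ := hb i hi
      have hsgn := congrFun (signed_eq_halfTurn P hanti k (σ' i).2 ((σ' i).1.1 : ℕ)) j
      have e1 : (if (σ' i).2 = 0 then P (sectorCenter k (σ' i).1.1) j else -P (sectorCenter k (σ' i).1.1) j) =
          (if (σ' i).2 = 0 then P (sectorCenter k (σ' i).1.1) else -P (sectorCenter k (σ' i).1.1)) j := by
        split_ifs <;> rfl
      rw [e1, hsgn]
      have hdist := torusDist_sectorCenter_sub_le_of_dvd (k := k) (a := (b : ℕ)) (a' := ht (σ' i)) (D := D) hdvd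
      have hD' : |(D : ℝ)| ≤ C' := by exact_mod_cast hD
      have hht' : sectorCenter k (if (σ' i).2 = 0 then ((σ' i).1.1 : ℕ) else
          if ((σ' i).1.1 : ℕ) < 2 ^ k then ((σ' i).1.1 : ℕ) + 2 ^ k else ((σ' i).1.1 : ℕ) - 2 ^ k) = sectorCenter k (ht (σ' i)) := by
        simp only [hht]
      rw [hht']
      calc |P (sectorCenter k (ht (σ' i))) j - P (sectorCenter k b) j|
          ≤ Lip * FermiRG.torusDist (sectorCenter k (ht (σ' i)) - sectorCenter k b) := hLip _ _ j
        _ ≤ Lip * (|(D : ℝ)| * sectorWidth k) := mul_le_mul_of_nonneg_left hdist hLip0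
        _ ≤ Lip * (C' * sectorWidth k) := by gcongr
    -- split the signed sum at `p`
    have hsplit : ∑ i, (if (σ' i).2 = 0 then P (sectorCenter k (σ' i).1.1) j else -P (sectorCenter k (σ' i).1.1) j) =
        (if ℓ.2 = 0 then P (sectorCenter k ℓ.1.1) j else -P (sectorCenter k ℓ.1.1) j) +
          ∑ i ∈ univ.erase p, (if (σ' i).2 = 0 then P (sectorCenter k (σ' i).1.1) j else -P (sectorCenter k (σ' i).1.1) j) := by
      rw [← Finset.add_sum_erase _ _ (mem_univ p), hσp]
    have hrest : |∑ i ∈ univ.erase p, (if (σ' i).2 = 0 then P (sectorCenter k (σ' i).1.1) j else -P (sectorCenter k (σ' i).1.1) j) -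
        (m : ℝ) * P (sectorCenter k b) j| ≤ m * (Lip * (C' * sectorWidth k)) := by
      have hcard : ((univ.erase p).card : ℝ) = m := by
        rw [Finset.card_erase_of_mem (mem_univ _), Finset.card_univ, Fintype.card_fin]; simp
      have e : (m : ℝ) * P (sectorCenter k b) j = ∑ _i ∈ univ.erase p, P (sectorCenter k b) j := by
        rw [Finset.sum_const, nsmul_eq_mul, hcard]
      rw [e, ← Finset.sum_sub_distrib]
      calc |∑ i ∈ univ.erase p, ((if (σ' i).2 = 0 then P (sectorCenter k (σ' i).1.1) j else -P (sectorCenter k (σ' i).1.1) j) -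
              P (sectorCenter k b) j)|
          ≤ ∑ i ∈ univ.erase p, |(if (σ' i).2 = 0 then P (sectorCenter k (σ' i).1.1) j else -P (sectorCenter k (σ' i).1.1) j) -
              P (sectorCenter k b) j| := Finset.abs_sum_le_sum_abs _ _
        _ ≤ ∑ _i ∈ univ.erase p, Lip * (C' * sectorWidth k) := Finset.sum_le_sum fun i hi => hleg i (Finset.ne_of_mem_erase hi)
        _ = m * (Lip * (C' * sectorWidth k)) := by rw [Finset.sum_const, nsmul_eq_mul, hcard]
    rw [hsplit] at honj
    -- combine
    have := abs_sub_le ((m : ℝ) * P (sectorCenter k b) j)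
      (∑ i ∈ univ.erase p, (if (σ' i).2 = 0 then P (sectorCenter k (σ' i).1.1) j else -P (sectorCenter k (σ' i).1.1) j))
      (2 * π * (G₀ j : ℝ) - (if ℓ.2 = 0 then P (sectorCenter k ℓ.1.1) j else -P (sectorCenter k ℓ.1.1) j))
    rw [abs_sub_comm] at hrest
    have h3 : |∑ i ∈ univ.erase p, (if (σ' i).2 = 0 then P (sectorCenter k (σ' i).1.1) j else -P (sectorCenter k (σ' i).1.1) j) -
        (2 * π * (G₀ j : ℝ) - (if ℓ.2 = 0 then P (sectorCenter k ℓ.1.1) j else -P (sectorCenter k ℓ.1.1) j))| ≤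
        ((m : ℝ) + 1) * C * sectorWidth k := by
      have e : ∑ i ∈ univ.erase p, (if (σ' i).2 = 0 then P (sectorCenter k (σ' i).1.1) j else -P (sectorCenter k (σ' i).1.1) j) -
          (2 * π * (G₀ j : ℝ) - (if ℓ.2 = 0 then P (sectorCenter k ℓ.1.1) j else -P (sectorCenter k ℓ.1.1) j)) =
          (if ℓ.2 = 0 then P (sectorCenter k ℓ.1.1) j else -P (sectorCenter k ℓ.1.1) j) +
            ∑ i ∈ univ.erase p, (if (σ' i).2 = 0 then P (sectorCenter k (σ' i).1.1) j else -P (sectorCenter k (σ' i).1.1) j) -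
            2 * π * (G₀ j : ℝ) := by ring
      rw [e]; exact honj
    linarith
  -- every admissible `b` is within `δ′` of `b₀′`
  have hnear : ∀ σ' ∈ S, ∀ b : Fin (sectorCount k),
      (∀ i, i ≠ p → ∃ D : ℤ, |D| ≤ C' ∧ (sectorCount k : ℤ) ∣ (((ht (σ' i) : ℕ) : ℤ) - b - D)) →
      FermiRG.torusDist (sectorCenter k b - sectorCenter k b₀') ≤ δ' := by
    intro σ' hσ' b hb
    obtain ⟨r, hr, hPr⟩ := hpolar (sectorCenter k b)
    obtain ⟨r₀, hr₀, hPr₀⟩ := hpolar (sectorCenter k b₀')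
    -- coordinatewise closeness of `P(θ_b)` and `P(θ_{b₀})`
    have hcl : ∀ j : Fin 2, |P (sectorCenter k b) j - P (sectorCenter k b₀') j| ≤ (4 * C + 2 * Lip * C') * sectorWidth k := by
      intro j
      have h1 := hkey σ' hσ' b hb j
      have h2 := hkey σ₀ hσ₀ b₀' hb₀' j
      have h3 : |(m : ℝ) * P (sectorCenter k b) j - (m : ℝ) * P (sectorCenter k b₀') j| ≤
          2 * (((m : ℝ) + 1) * C * sectorWidth k + m * (Lip * (C' * sectorWidth k))) := by
        have := abs_sub_le ((m : ℝ) * P (sectorCenter k b) j)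
          (2 * π * (G₀ j : ℝ) - (if ℓ.2 = 0 then P (sectorCenter k ℓ.1.1) j else -P (sectorCenter k ℓ.1.1) j))
          ((m : ℝ) * P (sectorCenter k b₀') j)
        rw [abs_sub_comm] at h2
        linarith
      rw [← mul_sub, abs_mul, abs_of_nonneg (by positivity : (0 : ℝ) ≤ m)] at h3
      -- divide by `m ≥ 1`: `(m+1)/m ≤ 2`
      have hm0 : (0 : ℝ) < m := by linarith
      have h4 : |P (sectorCenter k b) j - P (sectorCenter k b₀') j| ≤
          2 * (((m : ℝ) + 1) * C * sectorWidth k + m * (Lip * (C' * sectorWidth k))) / m := by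
        rw [le_div_iff₀ hm0]; linarith
      refine h4.trans ?_
      rw [div_le_iff₀ hm0]
      have : ((m : ℝ) + 1) ≤ 2 * m := by linarith
      have hCw : 0 ≤ C * sectorWidth k := by positivity
      nlinarith [hCw, mul_nonneg hLip0 (mul_nonneg (Nat.cast_nonneg C') hw.le)]
    have h0' := hcl 0; have h1' := hcl 1
    rw [hPr, hPr₀] at h0' h1'
    simp only [Pi.smul_apply, smul_eq_mul, dir_zero, dir_one] at h0' h1'
    have hmain := torusDist_le_of_polar_close humin hr hr₀ h0' h1'
    rw [hδ', le_div_iff₀ humin]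
    linarith
  -- assemble: `S ⊆ ⋃_{b near b₀′} T b`
  set Badm := (univ : Finset (Fin (sectorCount k))).filter fun b : Fin (sectorCount k) =>
    FermiRG.torusDist (sectorCenter k b - sectorCenter k b₀') ≤ δ' with hBadm
  have hcover : S ⊆ Badm.biUnion T := by
    intro σ' hσ'
    obtain ⟨hσp, -, b, hb⟩ := (hSdef' σ').1 hσ'
    rw [Finset.mem_biUnion]
    refine ⟨b, ?_, ?_⟩
    · rw [hBadm, mem_filter]; exact ⟨mem_univ _, hnear σ' hσ' b hb⟩
    · rw [hT, Fintype.mem_piFinset]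
      intro i
      by_cases hi : i = p
      · rw [if_pos hi, Finset.mem_singleton, hi, hσp]
      · rw [if_neg hi, hLbl, mem_filter]; exact ⟨mem_univ _, hb i hi⟩
  have hBcard : (Badm.card : ℝ) ≤ 2 * (2 * δ') / sectorWidth k + 2 :=
    card_sectors_torusDist_le k (sectorCenter k b₀') δ' hδ'0 b₀' (by rw [sub_self]; unfold FermiRG.torusDist; simp [hδ'0])
  have hB' : 2 * (2 * δ') / sectorWidth k + 2 = 4 * π * (4 * C + 2 * Lip * C') / umin + 2 := by
    rw [hδ']; field_simp; ring
  calc ((S.card : ℕ) : ℝ) ≤ ((Badm.biUnion T).card : ℝ) := by exact_mod_cast Finset.card_le_card hcover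
    _ ≤ ∑ b ∈ Badm, ((T b).card : ℝ) := by exact_mod_cast Finset.card_biUnion_le
    _ ≤ ∑ _b ∈ Badm, (4 * (2 * (C' : ℝ) + 1)) ^ m := Finset.sum_le_sum fun b _ => hT_card b
    _ = Badm.card * (4 * (2 * (C' : ℝ) + 1)) ^ m := by rw [Finset.sum_const, nsmul_eq_mul]
    _ ≤ (4 * π * (4 * C + 2 * Lip * C') / umin + 2) * (4 * (2 * (C' : ℝ) + 1)) ^ m := by
        rw [← hB']; exact mul_le_mul_of_nonneg_right hBcard (by positivity)


end Summit.HubbardSuperconductivity.HubbardSuperconductivity.Theorems.PerturbedFermiCurve
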